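import Summits.Ventures.PercRepro.BridgeTheorem
import Summits.Ventures.PercRepro.Transport

/-!
# PercRepro — the 2|2 bridge theorem in the «G has a bridge» form (p1, gen 4; proofs/P1-bridge-lemma.md §1)

`G.IsTwoTwoBridge P e₀ a b c d`: the vertex predicate `P` holds at `a, b` and fails at `c, d`, the edge `e₀` runs
from `P` to `¬P`, and every other edge has both ends on one side.  Such a `G` is the 1-sum of its two sides
along `e₀` up to renaming (typer-2's `mapVertices` / `mapEdges` / `SameEnds`), so `cubeSumC011_bridgeSum_nonneg`
transports: **`0 ≤ G.cubeSumC011 ![a, b, c, d]`** (`cubeSumC011_nonneg_of_twoTwoBridge`).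
-/

namespace PercRepro

namespace MultiGraph

variable {V E : Type} (G : MultiGraph V E)

/-- `e₀` is a bridge of `G` separating the marks `a, b` (side `P`) from `c, d` (side `¬P`). -/
structure IsTwoTwoBridge (P : V → Prop) (e₀ : E) (a b c d : V) : Prop where
  /-- `a` is on the `P` side. -/
  ha : P a
  /-- `b` is on the `P` side. -/
  hb : P b
  /-- `c` is on the `¬P` side. -/
  hc : ¬ P c
  /-- `d` is on the `¬P` side. -/
  hd : ¬ P d
  /-- the bridge starts on the `P` side -/
  hfst : P (G.fst e₀)
  /-- the bridge ends on the `¬P` side -/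
  hsnd : ¬ P (G.snd e₀)
  /-- every other edge has both ends on one side -/
  hother : ∀ e, e ≠ e₀ → (P (G.fst e) ↔ P (G.snd e))

section Sides

variable (P : V → Prop)

/-- The `P` side of `G`: vertices with `P`, edges with both ends in `P`. -/
def sideGraph : MultiGraph {v // P v} {e // P (G.fst e) ∧ P (G.snd e)} where
  fst e := ⟨G.fst e.1, e.2.1⟩
  snd e := ⟨G.snd e.1, e.2.2⟩

/-- The `¬P` side of `G`. -/
def cosideGraph : MultiGraph {v // ¬ P v} {e // ¬ P (G.fst e) ∧ ¬ P (G.snd e)} where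
  fst e := ⟨G.fst e.1, e.2.1⟩
  snd e := ⟨G.snd e.1, e.2.2⟩

/-- The vertex map from the two sides back into `V` (injective: the sides are disjoint). -/
def sideVertex : {v // P v} ⊕ {v // ¬ P v} → V := Sum.elim Subtype.val Subtype.val

/-- `sideVertex` is injective. -/
theorem sideVertex_injective : Function.Injective (sideVertex (V := V) P) := by
  rintro (x | x) (y | y) h
  · exact congrArg Sum.inl (Subtype.ext h)
  · have hxy : x.1 = y.1 := h
    exact absurd (hxy ▸ x.2) y.2
  · have hxy : x.1 = y.1 := h
    exact absurd (hxy ▸ y.2) x.2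
  · exact congrArg Sum.inr (Subtype.ext h)

end Sides

open Classical in
/-- The edge bijection between the 1-sum of the sides and `E`, for a 2|2 bridge. -/
noncomputable def sideEdgeEquiv {P : V → Prop} {e₀ : E} {a b c d : V} (hB : G.IsTwoTwoBridge P e₀ a b c d) :
    {e // P (G.fst e) ∧ P (G.snd e)} ⊕ ({e // ¬ P (G.fst e) ∧ ¬ P (G.snd e)} ⊕ Unit) ≃ E where
  toFun := Sum.elim Subtype.val (Sum.elim Subtype.val fun _ => e₀)
  invFun e :=
    if h : P (G.fst e) ∧ P (G.snd e) then Sum.inl ⟨e, h⟩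
    else if h' : ¬ P (G.fst e) ∧ ¬ P (G.snd e) then Sum.inr (Sum.inl ⟨e, h'⟩)
    else Sum.inr (Sum.inr ())
  left_inv := by
    rintro (e | e | e)
    · simp [e.2]
    · simp [e.2]
    · have h1 : ¬ (P (G.fst e₀) ∧ P (G.snd e₀)) := fun h => hB.hsnd h.2
      have h2 : ¬ (¬ P (G.fst e₀) ∧ ¬ P (G.snd e₀)) := fun h => h.1 hB.hfst
      simp [h1, h2]
  right_inv := by
    intro e
    by_cases h : P (G.fst e) ∧ P (G.snd e)
    · simp [h]
    · by_cases h' : ¬ P (G.fst e) ∧ ¬ P (G.snd e)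
      · simp [h']
      · -- an edge neither inside nor outside is the bridge
        have he : e = e₀ := by
          by_contra hne
          have := hB.hother e hne
          by_cases hf : P (G.fst e)
          · exact h ⟨hf, this.1 hf⟩
          · exact h' ⟨hf, fun hs => hf (this.2 hs)⟩
        have h1 : ¬ (P (G.fst e₀) ∧ P (G.snd e₀)) := fun h => hB.hsnd h.2
        have h2 : ¬ (¬ P (G.fst e₀) ∧ ¬ P (G.snd e₀)) := fun h => h.1 hB.hfst
        simp [he, h1, h2]

/-- The 1-sum of the two sides, pushed back to `V` and `E`, has the same endpoint sets as `G`. -/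
theorem sameEnds_of_twoTwoBridge {P : V → Prop} {e₀ : E} {a b c d : V} (hB : G.IsTwoTwoBridge P e₀ a b c d) :
    SameEnds G ((((G.sideGraph P).bridgeSum (G.cosideGraph P) ⟨G.fst e₀, hB.hfst⟩ ⟨G.snd e₀, hB.hsnd⟩).mapVertices
      (sideVertex P)).mapEdges (G.sideEdgeEquiv hB)) := by
  classical
  intro e
  left
  simp only [mapEdges, mapVertices, Function.comp]
  rcases hinv : (G.sideEdgeEquiv hB).symm e with f | f | f
  · have he : e = f.1 := by
      have := congrArg (G.sideEdgeEquiv hB) hinv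
      rw [Equiv.apply_symm_apply] at this
      exact this
    subst he
    exact ⟨rfl, rfl⟩
  · have he : e = f.1 := by
      have := congrArg (G.sideEdgeEquiv hB) hinv
      rw [Equiv.apply_symm_apply] at this
      exact this
    subst he
    exact ⟨rfl, rfl⟩
  · have he : e = e₀ := by
      have := congrArg (G.sideEdgeEquiv hB) hinv
      rw [Equiv.apply_symm_apply] at this
      exact this
    subst he
    exact ⟨rfl, rfl⟩

/-- **THE 2|2 BRIDGE CASE OF LEMMA B⁺, «G has a bridge» form**: if some edge `e₀` of `G` separates the marks
`a, b` from `c, d`, the C-011 class sum `CS(G; a, b, c, d)` is nonnegative. -/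
theorem cubeSumC011_nonneg_of_twoTwoBridge [Fintype E] [DecidableEq E] {P : V → Prop} {e₀ : E} {a b c d : V}
    (hB : G.IsTwoTwoBridge P e₀ a b c d) : 0 ≤ G.cubeSumC011 ![a, b, c, d] := by
  classical
  rw [← cubeSumC011_eq_of_sameEnds (G.sameEnds_of_twoTwoBridge hB), cubeSumC011_mapEdges]
  have hm : (![a, b, c, d] : Fin 4 → V) = sideVertex P ∘
      ![Sum.inl ⟨a, hB.ha⟩, Sum.inl ⟨b, hB.hb⟩, Sum.inr ⟨c, hB.hc⟩, Sum.inr ⟨d, hB.hd⟩] := by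
    funext i
    fin_cases i <;> rfl
  rw [hm, cubeSumC011_mapVertices _ (sideVertex_injective P)]
  exact ((G.sideGraph P).cubeSumC011_bridgeSum_nonneg (G.cosideGraph P) _ _ _ _ _ _)

end MultiGraph

end PercRepro
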